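import Literature.MathematicalPhysics.QuantumFieldTheory.Balaban1983to89.B9Thm310DeltaAIsUnitOfExpansion

/-!
# `Balaban1983to89.B9Thm310GOfLocalInverseReg335` — T. Bałaban, *Propagators for lattice gauge theories in a background field*, Commun. Math. Phys. **99**
# (1985) 389–434 [Balaban1985BackgroundPropagators], Thm 3.3 p. 399 via Thm 3.10 pp. 414–416 ON THE CLASS (3.35) p. 396 AT THE FIBRE `M_N(ℂ)`: the (QB1)
# endpoints of module M5.7 (`B9Thm310DeltaAIsUnitOfExpansion.eBlock_kernelFamilyBInv_GAY_of_localInverseCubes''` ∕ `…''_exact`: Thm 3.3's block estimate for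
# def-Y's `G(U₁) = Δ_a(U₁)⁻¹` from an ARBITRARY family of cube letters with local-inverse laws) with the PLAQUETTE DATUM READ OFF PRINT'S CLASS (3.35) — one name
# for the (B)-line knit at the model fibre (cell `lit-balaban`, sub-row G-B9-LETTERS, module M5.7 FILE (QB1)-B5; seat p38 gen 41)

statement-level skeleton of published theorems with citation tags; proofs where landed; nothing here is a claim about the Yang–Mills mass gap

CITATION HEADER (lean-in-tree rule).  B9 = T. Bałaban, *Propagators for lattice gauge theories in a background field*, Commun. Math. Phys. **99** (1985)
389–434 (PDF held: `paper:balaban1985-cmp99-background-propagators`, journal page = PDF page + 388).  p. 396 (3.35) (the class of backgrounds: `|A| ≦ O(1)Mα₀(Lʲη)⁻¹`,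
`|∇A| ≦ O(1)Mα₀(Lʲη)⁻²` on the big cubes of `Ω_j`, in the gauges of the cubes, «where O(1)M is a size of □ in T_{L⁻ʲ}»); p. 404 (3.69) «|(Δ′(U′U)λ′)(b)| ≦
O(1)(Mα₀ + α₁)(Lʲη)⁻² sup|λ′|, b ∈ Ω_j» and, right after it on p. 404, «This bound follows from the estimates» [display: the plaquette variables `U′U(∂p)` near 1] «and the
estimates follow directly from the assumptions (3.35), (3.37)» — the plaquette bound `|U(∂p) − 1| ≤ O(1)Mα₀(Lʲη)⁻²`, `p ⊂ Ω_j`, used below is OUR READING of that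
display at `A′ = 0` (made explicit with constants by `B9Eq335PlaquetteAtLettersY` ∕ `…DataOfPlaquettes`), not a numbered formula of print; p. 399
Theorem 3.3 (3.42) p. 397 (the block estimate for `G(U)`); p. 414 (3.105) «Δ_aG₀ = I − Σ_□K(h_□)G_□h_□ − Σ_□(1 − ζ_□̃)DPD*h_□G_□h_□ − Σ_□ζ_□̃(DPD* − DP_□D*)h_□G_□h_□
− Σ_□ζ_□̃P_{□,1}(∂h_□)G_□h_□ = I − R» (LEFT form, the only one print displays), «For M sufficiently large this implies G = G₀(I − R)⁻¹ = Σ_{n=0}^∞ G₀Rⁿ. (3.106)»;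
p. 409 (3.87) and l. 3–5 (the cube letters `G_□`), p. 409 (3.89) «|(K(h_□)G′_□h_□λ)(x)| ≦ O(M⁻¹)e^{−δ₀(Lʲη)⁻¹|y−y′|}|λ|» (as printed; the cell's explicit
`θ₃.₈₉(B₀, b₁, δ₀; δ̂)·M⁻¹` is our reading of it with constants); p. 410 l. 2–3 «This theorem follows simply from Corollary 3.6 holding for all G′_□, □ ∈ 𝒟, from
the bound (3.89) and Lemma 2.1.»; p. 416 Theorem 3.10, «Theorem 3.10 implies Theorem 3.3».  [4] = [Balaban1984PropagatorsII] (2.2) p. 224, Prop. 2.2 (2.65)–(2.67)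
p. 234, Lemma 2.1 (2.61) p. 234.  Rows B9.Thm3.3 × B9.Thm3.10 × B9.Eq3.35 × B9.Eq3.69 (cells only; no row head changes).

WHY THIS FILE.  The (QB1) endpoints are stated at a general complete normed `ℂ`-algebra fibre `𝔸` and display the plaquette datum
`hW : ‖U₁(∂p) − 1‖ ≤ δ̂·(L^{lev p})⁻²` (every plaquette) together with `0 ≤ δ̂`.  On print's class (3.35) at the model fibre `M_N(ℂ)` (def-Y's `bg9KP`, operator
norm) that datum is a THEOREM of the tree — `B9Thm310CommutatorDataOfPlaquettes.plaquetteDefect_of_reg335P`: `‖U(∂p) − 1‖ ≤ 2K(1+K)e^{4K}·L²·(L^{lev p})⁻²`,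
`K := 10L·(Mα₀)`, for EVERY plaquette, no coverage hypothesis — exactly as `B9Thm310CommutatorSum` §4 (`hasMajorant_sum_conj_KhBY_GACubeY_hTY_of_reg335P`) did for
the first family alone.  THIS FILE threads it through the two (QB1) endpoints, for every `δ̂` above that constant (hypothesis `hδK`; `le_rfl` gives the sharp one),
so a consumer working on the class (3.35) at `M_N(ℂ)` cites ONE name and supplies neither `hW` nor `0 ≤ δ̂`.

WHAT IS PROVED (all `theorem`s, 0 `def`, 0 sorry, 0 new named facts).
* ★★★ `eBlock_kernelFamilyBInv_GAY_of_localInverseCubes''_of_reg335P` — `…DeltaAIsUnitOfExpansion.eBlock_kernelFamilyBInv_GAY_of_localInverseCubes''` at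
  `𝔸 := M_N(ℂ)`, `U₁ ∈` (3.35) (`(bg9KP (M_N(ℂ)) G i).Reg335 c₀ α₀ (cfg U₁)`, `c₀ ≤ 10`, `0 ≤ Mα₀`), `hW` and `0 ≤ δ̂` discharged (defect laws `hdef`∕`hdefT`).
* ★★★ `eBlock_kernelFamilyBInv_GAY_of_localInverseCubes''_exact_of_reg335P` — the same for the exact-law endpoint `…''_exact`.
* §2 (v1.2) ★★★ `eBlock_kernelFamilyBInv_GAY_of_coverCubes''_of_reg335P` — the same for the landed consumer at r05's whole-torus cube letters `GACubeY`
  (`…DeltaAIsUnitOfExpansion.eBlock_kernelFamilyBInv_GAY_of_coverCubes''` = `…TransposedCommutatorBMajorant.eBlock_kernelFamilyBInv_GAY_of_coverCubes'` without `hinvU`;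
  `hinvC : ∀ □, IsUnit Δ_{a,□}(U₁)` stays displayed).

HONEST SCOPE.  Pure threading: no new analysis, no new hypothesis beyond membership in (3.35) (and `c₀ ≤ 10`, `0 ≤ Mα₀`, `δ̂ ≥ 2K(1+K)e^{4K}L²`); everything else
the (QB1) endpoint displays STAYS displayed — the cube letters' (3.42) blocks `hE` (module M5.1b-G′'s successor item for the cut letter; r05's `GACubeY` road for
the whole-torus letter), the (3.101) law `hP1`, the local-inverse laws `hdef`∕`hdefT` (resp. `hloc`∕`hlocT`), families 2–4 (+ the defect family) of `R` and of its
transposed reading (`hrest`, `hV′`; cell GAPS G-B9-05∕06a∕07), bi-contractivity `hU`∕`hT` (automatic for a unitary-valued configuration, not derived here), `η = |c_f|⁻¹`,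
`0 ≤ b₁`, [4] Lemma 2.1 ((2.61), (2.63)), the two smallness conditions («M sufficiently large»).  DEFECT LABEL: the defect families are an (R)-design term, NOT in
print; `= 0` for print's `G_□ = (Δ_{loc,□} − DP_□D*)⁻¹` on the cube sequence (p. 409 l. 3–5) and for r05's `GACubeY` letters.  Nothing continuum ∕ OS ∕ mass gap ∕
Clay; YM mass gap NOT proved by any of this (Track A conditional rung).  `--supports stmt-QuantumFields-19200`.  RELATED, NOT DUPLICATED (searched 2026-08-28:
`rg 'theorem .*[rR]eg335' B9Thm310*.lean` — only `B9Thm310CommutatorSum.hasMajorant_sum_conj_KhBY_GACubeY_hTY_of_reg335P` (first family, `GACubeY` letters) and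
`…DataOfPlaquettes.plaquetteDefect_of_reg335P` (the datum itself) exist; no endpoint of module M5.7 had a (3.35) reading).
-/

noncomputable section

namespace Literature.MathematicalPhysics.QuantumFieldTheory.Balaban1983to89.B9Thm310GOfLocalInverseReg335

open Node00 B9CubeLettersInvReadings
open B6GlobalChartV1 (blkV1)
open B6Ineq2142KLevelV1 (β)
open B6KLevelCensusIndexV1 (KIdx kGeo)
open B6Cover236MultiLevelBlocks (cubes)
open B6Partition118KLevelFineSizes (C1F)
open B6Partition118KLevelFineSecond (C2F)
open B6Partition118KLevelFineMixed (C2X)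
open B6Partition118KLevelTorusBinders (sLipT)
open B6RandomWalk (HasMajorant Ineq261 Ineq263)
open B9Thm34Ext (toB6)
open B9FromB6 (EBlock)
open B9GeoNormsKLevelV1 (geo9K)
open B9Eq352DivFormLetters (conj)
open B9Thm37CubeCoverCommutators (cutMulY hTY)
open B9Eq3104CutoffCommutators (hBdY DPDsY deltaLocY)
open B9Thm310CommutatorBound389B (theta389B)
open B9Thm310CommutatorDataOfPlaquettes (plaquetteDefect_of_reg335P)
open B9Thm310DeltaAIsUnitOfExpansion (eBlock_kernelFamilyBInv_GAY_of_localInverseCubes'' eBlock_kernelFamilyBInv_GAY_of_localInverseCubes''_exact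
  eBlock_kernelFamilyBInv_GAY_of_coverCubes'')
open B9CubeLettersBondOpsL0 (deltaACubeY GACubeY)
open B9Eq3105AtLetters (DPDsCubeY P1CubeY)
open Node00.OpsYNablaBridge (chartY)
open scoped Matrix

section Reg335

open scoped Matrix.Norms.L2Operator
open B9BackgroundsKLevelV1 B9BackgroundsKLevelV1P

variable {d ℓ : ℕ} {hd : 1 ≤ d + 1} {hL : Odd (ℓ + 1) ∧ 1 < ℓ + 1} {b₀ b₁ : ℝ} {N : ℕ} [Nonempty (Fin N)]
variable {ι : Type} [Fintype ι] [DecidableEq ι]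
variable (i : KIdx d ℓ hd hL b₀ b₁) (b : Module.Basis ι ℝ (Matrix (Fin N) (Fin N) ℂ))
variable [Fintype (geo9K i).Site] [DecidableEq (geo9K i).Site] {Rr : ℝ} {Hp : Prop}
variable (ιB : BlkY i → IBondY i)
variable {B : B9.Backgrounds} (cfg : B.Cfg → CfgY (Matrix (Fin N) (Fin N) ℂ) i) (par : BondParY (Matrix (Fin N) (Fin N) ℂ) i) {U₁ : B.Cfg}

/-- ★★★ **THE (QB1) ENDPOINT ON PRINT'S CLASS (3.35)** (fibre `M_N(ℂ)` with the operator norm, `N ≥ 1`; def-Y's `bg9KP`, threshold `c₀ ≤ 10`, `M·α₀ ≥ 0`):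
`B9Thm310DeltaAIsUnitOfExpansion.eBlock_kernelFamilyBInv_GAY_of_localInverseCubes''` VERBATIM at `𝔸 := M_N(ℂ)` except that the plaquette datum `hW`
(`‖U₁(∂p) − 1‖ ≤ δ̂·(L^{lev p})⁻²` for every plaquette) and `0 ≤ δ̂` are NO LONGER DISPLAYED: they are read off `U₁ ∈` (3.35) by
`B9Thm310CommutatorDataOfPlaquettes.plaquetteDefect_of_reg335P` for every `δ̂ ≥ 2K(1+K)e^{4K}·L²`, `K := 10L·(Mα₀)` (hypothesis `hδK`; `le_rfl` gives the sharp
constant) — print: (3.35) bounds `|A|, |∇A|` on the cubes of `Ω_j` by `O(1)Mα₀(Lʲη)^{−1,−2}`, whence the plaquette estimate behind (3.69) p. 404 («the estimates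
follow directly from the assumptions (3.35), (3.37)»; our reading at `A′ = 0`: `|U(∂p) − 1| ≤ O(1)Mα₀(Lʲη)⁻²`, `p ⊂ Ω_j`), so the (3.89) sizes are uniform in `j`.
Still displayed, exactly as in `…''`: the cube letters' (3.42) blocks `hE`, the (3.101) law `hP1`, the local-inverse laws up to the defects `hdef`∕`hdefT`,
families 2–4 + the defect family (`hrest`, `hV′`), bi-contractivity `hU`∕`hT` (unitary fibre), `η = |c_f|⁻¹`, `0 ≤ b₁`, [4] Lemma 2.1, the two smallness
conditions («M sufficiently large»).  DEFECT LABEL: the defect families `Σ_□E_□` ∕ `Σ_□E♯_□` are an (R)-design term, NOT in print; `= 0` for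
print's `G_□ = (Δ_{loc,□} − DP_□D*)⁻¹` on the cube sequence (p. 409 l. 3–5) and for r05's `GACubeY` letters.
[cite: Balaban1985BackgroundPropagators, Thm 3.3 p.399 (3.42) p.397 via Thm 3.10 pp.414–416, (3.35) p.396, (3.69) p.404, (3.105)–(3.106) p.414, (3.87) p.409, p.409 l.3–5, p.410 l.2–3; Balaban1984PropagatorsII, Prop. 2.2 (2.65)–(2.67) p.234, Lemma 2.1 (2.61) p.234] -/
theorem eBlock_kernelFamilyBInv_GAY_of_localInverseCubes''_of_reg335P (hι : ∀ s, β i.hN i.D i.hk (ιB s) = s)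
    {M₂ : ℝ} (hM₂ : 0 ≤ M₂) (hrepr : ∀ (v : Matrix (Fin N) (Fin N) ℂ) (j : ι), |b.repr v j| ≤ M₂ * ‖v‖) (hη : etaS i = |i.cf|⁻¹) (hb₁ : 0 ≤ b₁)
    (parS : SiteParY (Matrix (Fin N) (Fin N) ℂ) i) (parB : BondParY (Matrix (Fin N) (Fin N) ℂ) i) (Gp : SiteOpY (Matrix (Fin N) (Fin N) ℂ) i)
    (ζ : ↥(cubes i.D.toDomains) → SiteY i → ℝ) (hζ : ∀ c z, hTY i c z ≠ 0 → ζ c z = 1)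
    (Oc : ↥(cubes i.D.toDomains) → BondOpY (Matrix (Fin N) (Fin N) ℂ) i)
    (Pl P1l E Et : ↥(cubes i.D.toDomains) → Module.End ℂ (FBondY i → Matrix (Fin N) (Fin N) ℂ))
    (hP1 : ∀ c, Pl c * cutMulY (hBdY i (hTY i c)) = cutMulY (hBdY i (hTY i c)) * Pl c + P1l c)
    (hdef : ∀ c, cutMulY (hBdY i (hTY i c)) * (deltaLocY i parB (cfg U₁) - Pl c) * Oc c (cfg U₁) * cutMulY (hBdY i (hTY i c)) =
      cutMulY (hBdY i (hTY i c)) * cutMulY (hBdY i (hTY i c)) - E c)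
    (hdefT : ∀ c, cutMulY (hBdY i (hTY i c)) * Oc c (cfg U₁) * (deltaLocY i parB (cfg U₁) - Pl c) * cutMulY (hBdY i (hTY i c)) =
      cutMulY (hBdY i (hTY i c)) * cutMulY (hBdY i (hTY i c)) - Et c)
    (D Ds : Fin (d + 1) → Module.End ℝ (FBondY i → Matrix (Fin N) (Fin N) ℂ))
    (hD : ∀ ν Λ, D ν Λ = cdB i (cfg U₁) ν Λ) (hDs : ∀ ν Λ, Ds ν Λ = cdsB i (cfg U₁) ν Λ)
    (Lp : Module.End ℝ (FBondY i → Matrix (Fin N) (Fin N) ℂ)) (hLp : ∀ Λ, Lp Λ = lapB i (cfg U₁) Λ)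
    (d' : ℕ) {δ₀ α Θ' θV' B₀ δh : ℝ}
    (hB₀ : 0 ≤ B₀) (hδ₀ : 0 ≤ δ₀) (hΘ' : 0 ≤ Θ') (hθV' : 0 ≤ θV')
    (hαδ : 0 ≤ α * δ₀) (hαδ2 : 0 ≤ (1 - 2 * α) * δ₀)
    (h261 : Ineq261 d' (toB6 (geo9K i) Rr Hp) δ₀ α) (h263 : Ineq263 d' (toB6 (geo9K i) Rr Hp) δ₀ α)
    (hsmall : ((3 * 5 ^ (d + 1) * (Real.exp (α * δ₀ * (2 * (ℓ : ℝ) + 6)) * B6.c1 d' δ₀ α)) *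
        (M₂ * (∑ j, ‖b j‖) * theta389B d ℓ B₀ b₁ δ₀ 1 (2 * δh) (δh * (((ℓ : ℝ) + 1) ^ 2 + 1)) δh 0 * ((geo9K i).M)⁻¹) + Θ') * B6.c1 d' δ₀ α < 1)
    (hsmallV : ((3 * 5 ^ (d + 1) * (Real.exp (α * δ₀ * (2 * (ℓ : ℝ) + 6)) * B6.c1 d' δ₀ α)) *
          (M₂ * (∑ j, ‖b j‖) *
            ((B₀ * (((d : ℝ) + 1) * (Real.exp (α * δ₀ * 2) * B6.c1 d' δ₀ α) * Real.exp (δ₀ * 2)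
                * ((2 * ((d : ℝ) + 1) + 4) * (5 / 8 * C1F d ℓ / i.Mh) + (5 / 8) ^ 2 * (C2F d ℓ + 2 * C2X d ℓ) / (i.Mh : ℝ) ^ 2
                    + 8 * δh * ((ℓ : ℝ) + 1) ^ 5 * (5 / 8 * C1F d ℓ / i.Mh) + 64 * δh * ((ℓ : ℝ) + 1) ^ 7 * (5 / 8 * C1F d ℓ / i.Mh))
              + (Real.exp (α * δ₀ * (2 * (ℓ : ℝ) + 6)) * B6.c1 d' δ₀ α) * Real.exp (δ₀ * (2 * (ℓ : ℝ) + 6))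
                * (4 * b₁ * ((ℓ : ℝ) + 1) ^ 6 * (((ℓ : ℝ) + 1) ^ (d + 1)) ^ 5 * (sLipT d ℓ / (((ℓ : ℝ) + 1) * i.Mh) * (((ℓ : ℝ) + 1) + 3)))))
              * ((ℓ : ℝ) + 1) ^ 5)) + θV') * B6.c1 d' δ₀ α < 1)
    (hE : ∀ c : ↥(cubes i.D.toDomains), EBlock (kernelFamilyBInv i B cfg (Oc c) par) B₀ δ₀ U₁)
    (hU : ∀ μ x, ‖(cfg U₁ μ x : Matrix (Fin N) (Fin N) ℂ)‖ ≤ 1 ∧ ‖(((cfg U₁ μ x)⁻¹ : (Matrix (Fin N) (Fin N) ℂ)ˣ) : Matrix (Fin N) (Fin N) ℂ)‖ ≤ 1)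
    (hT : ∀ (y : IBondY i) (f : FBondY i), ‖(qT i parB (cfg U₁) y f : Matrix (Fin N) (Fin N) ℂ)‖ ≤ 1 ∧
      ‖(((qT i parB (cfg U₁) y f)⁻¹ : (Matrix (Fin N) (Fin N) ℂ)ˣ) : Matrix (Fin N) (Fin N) ℂ)‖ ≤ 1)
    {G : Subgroup (Matrix (Fin N) (Fin N) ℂ)ˣ} {c₀ α₀ : ℝ} (hc : c₀ ≤ 10) (hMα : 0 ≤ (kGeo i).M * α₀)
    (h335 : (bg9KP (Matrix (Fin N) (Fin N) ℂ) G i).Reg335 c₀ α₀ (cfg U₁))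
    (hδK : (2 * (10 * (kGeo i).L * ((kGeo i).M * α₀)) * (1 + 10 * (kGeo i).L * ((kGeo i).M * α₀)) *
        Real.exp (4 * (10 * (kGeo i).L * ((kGeo i).M * α₀))) * ((ℓ : ℝ) + 1) ^ 2) ≤ δh)
    (hrest : HasMajorant (g := toB6 (geo9K i) Rr Hp) (fun p : FBondY i × ι => ιB (blkV1 i.hN i.D p.1))
      (∑ c, conj b (((1 - cutMulY (hBdY i (ζ c))) * DPDsY i parS Gp (cfg U₁) *
            (cutMulY (hBdY i (hTY i c)) * Oc c (cfg U₁) * cutMulY (hBdY i (hTY i c)))).restrictScalars ℝ)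
        + ∑ c, conj b ((cutMulY (hBdY i (ζ c)) * (DPDsY i parS Gp (cfg U₁) - Pl c) *
            (cutMulY (hBdY i (hTY i c)) * Oc c (cfg U₁) * cutMulY (hBdY i (hTY i c)))).restrictScalars ℝ)
        + ∑ c, conj b ((cutMulY (hBdY i (ζ c)) * P1l c * Oc c (cfg U₁) * cutMulY (hBdY i (hTY i c))).restrictScalars ℝ)
        + ∑ c, conj b ((E c).restrictScalars ℝ))
      (fun a a' => Θ' * Real.exp (-(δ₀ * (geo9K i).dist a a'))))
    (hV' : HasMajorant (g := toB6 (geo9K i) Rr Hp) (fun p : FBondY i × ι => ιB (blkV1 i.hN i.D p.1))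
      (-(∑ c, conj b ((cutMulY (hBdY i (hTY i c)) * Oc c (cfg U₁) * P1l c).restrictScalars ℝ))
        + ∑ c, conj b ((cutMulY (hBdY i (hTY i c)) * Oc c (cfg U₁) * cutMulY (hBdY i (hTY i c)) *
            (cutMulY (hBdY i (ζ c)) * (DPDsY i parS Gp (cfg U₁) - Pl c))).restrictScalars ℝ)
        + ∑ c, conj b ((cutMulY (hBdY i (hTY i c)) * Oc c (cfg U₁) * cutMulY (hBdY i (hTY i c)) *
            ((1 - cutMulY (hBdY i (ζ c))) * DPDsY i parS Gp (cfg U₁))).restrictScalars ℝ)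
        + ∑ c, conj b ((Et c).restrictScalars ℝ))
      (fun a a' => θV' * (geo9K i).len a * ((geo9K i).len a')⁻¹ * Real.exp (-(δ₀ * (geo9K i).dist a a')))) :
    EBlock (kernelFamilyBInv i B cfg (GAY i parS parB Gp) par)
      (M₂ * (∑ j, ‖b j‖) *
        ((3 * 5 ^ (d + 1)) * (M₂ * (∑ j, ‖b j‖) * B₀) * B6.c1 d' δ₀ α *
            (1 - ((3 * 5 ^ (d + 1) * (Real.exp (α * δ₀ * (2 * (ℓ : ℝ) + 6)) * B6.c1 d' δ₀ α)) *
              (M₂ * (∑ j, ‖b j‖) * theta389B d ℓ B₀ b₁ δ₀ 1 (2 * δh) (δh * (((ℓ : ℝ) + 1) ^ 2 + 1)) δh 0 * ((geo9K i).M)⁻¹) + Θ') *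
              B6.c1 d' δ₀ α)⁻¹ +
          ((3 * 5 ^ (d + 1) * (Real.exp (α * δ₀ * (2 * (ℓ : ℝ) + 6)) * B6.c1 d' δ₀ α)) *
              (M₂ * (∑ j, ‖b j‖) * (B₀ * (1 + 5 * C1F d ℓ * (((ℓ : ℝ) + 1) * Real.exp δ₀) / (8 * (i.Mh : ℝ)))))) * B6.c1 d' δ₀ α *
            (1 - ((3 * 5 ^ (d + 1) * (Real.exp (α * δ₀ * (2 * (ℓ : ℝ) + 6)) * B6.c1 d' δ₀ α)) *
              (M₂ * (∑ j, ‖b j‖) * theta389B d ℓ B₀ b₁ δ₀ 1 (2 * δh) (δh * (((ℓ : ℝ) + 1) ^ 2 + 1)) δh 0 * ((geo9K i).M)⁻¹) + Θ') *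
              B6.c1 d' δ₀ α)⁻¹ +
          ((3 * 5 ^ (d + 1) * (Real.exp (α * δ₀ * (2 * (ℓ : ℝ) + 6)) * B6.c1 d' δ₀ α)) *
              (M₂ * (∑ j, ‖b j‖) * (B₀ * (1 + Real.exp (α * δ₀) * B6.c1 d' δ₀ α * Real.exp δ₀ * (5 / 8 * C1F d ℓ / i.Mh))))) * B6.c1 d' δ₀ α *
            (1 - ((3 * 5 ^ (d + 1) * (Real.exp (α * δ₀ * (2 * (ℓ : ℝ) + 6)) * B6.c1 d' δ₀ α)) *
                (M₂ * (∑ j, ‖b j‖) *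
                  ((B₀ * (((d : ℝ) + 1) * (Real.exp (α * δ₀ * 2) * B6.c1 d' δ₀ α) * Real.exp (δ₀ * 2)
                      * ((2 * ((d : ℝ) + 1) + 4) * (5 / 8 * C1F d ℓ / i.Mh) + (5 / 8) ^ 2 * (C2F d ℓ + 2 * C2X d ℓ) / (i.Mh : ℝ) ^ 2
                          + 8 * δh * ((ℓ : ℝ) + 1) ^ 5 * (5 / 8 * C1F d ℓ / i.Mh) + 64 * δh * ((ℓ : ℝ) + 1) ^ 7 * (5 / 8 * C1F d ℓ / i.Mh))
                    + (Real.exp (α * δ₀ * (2 * (ℓ : ℝ) + 6)) * B6.c1 d' δ₀ α) * Real.exp (δ₀ * (2 * (ℓ : ℝ) + 6))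
                      * (4 * b₁ * ((ℓ : ℝ) + 1) ^ 6 * (((ℓ : ℝ) + 1) ^ (d + 1)) ^ 5 * (sLipT d ℓ / (((ℓ : ℝ) + 1) * i.Mh) * (((ℓ : ℝ) + 1) + 3)))))
                    * ((ℓ : ℝ) + 1) ^ 5)) + θV') * B6.c1 d' δ₀ α)⁻¹ +
          ((3 * 5 ^ (d + 1) * (Real.exp (α * δ₀ * (2 * (ℓ : ℝ) + 6)) * B6.c1 d' δ₀ α)) *
              (M₂ * (∑ j, ‖b j‖) * (B₀ * (1 + ((d : ℝ) + 1) * (5 / 8 * C1F d ℓ / i.Mh * (Real.exp δ₀ + 1) + 25 / 64 * C2F d ℓ / i.Mh ^ 2))))) * B6.c1 d' δ₀ α *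
            (1 - ((3 * 5 ^ (d + 1) * (Real.exp (α * δ₀ * (2 * (ℓ : ℝ) + 6)) * B6.c1 d' δ₀ α)) *
              (M₂ * (∑ j, ‖b j‖) * theta389B d ℓ B₀ b₁ δ₀ 1 (2 * δh) (δh * (((ℓ : ℝ) + 1) ^ 2 + 1)) δh 0 * ((geo9K i).M)⁻¹) + Θ') *
              B6.c1 d' δ₀ α)⁻¹))
      ((1 - 2 * α) * δ₀) U₁ := by
  have hL0 : 0 ≤ (kGeo i).L := zero_le_one.trans (B9Eq335PlaquetteAtLettersY.one_le_L i)
  have hK : 0 ≤ 10 * (kGeo i).L * ((kGeo i).M * α₀) := mul_nonneg (mul_nonneg (by norm_num) hL0) hMα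
  have hδK0 : 0 ≤ (2 * (10 * (kGeo i).L * ((kGeo i).M * α₀)) * (1 + 10 * (kGeo i).L * ((kGeo i).M * α₀)) *
      Real.exp (4 * (10 * (kGeo i).L * ((kGeo i).M * α₀))) * ((ℓ : ℝ) + 1) ^ 2) := by positivity
  have hδh : 0 ≤ δh := hδK0.trans hδK
  have hW : ∀ p : PlaqY i, ‖((holY i (cfg U₁) p : (Matrix (Fin N) (Fin N) ℂ)ˣ) : Matrix (Fin N) (Fin N) ℂ) - 1‖ ≤
      δh * ((((ℓ : ℝ) + 1) ^ levY i (chartY i p.src))⁻¹) ^ 2 := fun p =>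
    (plaquetteDefect_of_reg335P i (cfg U₁) hc hMα h335 p).trans (mul_le_mul_of_nonneg_right hδK (sq_nonneg _))
  exact eBlock_kernelFamilyBInv_GAY_of_localInverseCubes'' i b ιB cfg par hι hM₂ hrepr hη hb₁ parS parB Gp ζ hζ Oc Pl P1l E Et hP1 hdef hdefT
    D Ds hD hDs Lp hLp d' hB₀ hδ₀ hΘ' hθV' hδh hαδ hαδ2 h261 h263 hsmall hsmallV hE hU hT hW hrest hV'

/-- ★★★ **THE EXACT-LAW (QB1) ENDPOINT ON PRINT'S CLASS (3.35)** (fibre `M_N(ℂ)`, `N ≥ 1`): `…DeltaAIsUnitOfExpansion.eBlock_kernelFamilyBInv_GAY_of_localInverseCubes''_exact`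
at `𝔸 := M_N(ℂ)` with the plaquette datum and `0 ≤ δ̂` read off `U₁ ∈` (3.35) (`…DataOfPlaquettes.plaquetteDefect_of_reg335P`; any `δ̂ ≥ 2K(1+K)e^{4K}·L²`,
`K := 10L·(Mα₀)`); exact local-inverse laws `hloc`∕`hlocT` (print's letters, p. 409 l. 3–5), no defect family.
[cite: Balaban1985BackgroundPropagators, Thm 3.3 p.399 (3.42) p.397 via Thm 3.10 pp.414–416, (3.35) p.396, (3.69) p.404, (3.105)–(3.106) p.414, (3.87) p.409, p.409 l.3–5; Balaban1984PropagatorsII, Prop. 2.2 (2.65)–(2.67) p.234, Lemma 2.1 (2.61) p.234] -/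
theorem eBlock_kernelFamilyBInv_GAY_of_localInverseCubes''_exact_of_reg335P (hι : ∀ s, β i.hN i.D i.hk (ιB s) = s)
    {M₂ : ℝ} (hM₂ : 0 ≤ M₂) (hrepr : ∀ (v : Matrix (Fin N) (Fin N) ℂ) (j : ι), |b.repr v j| ≤ M₂ * ‖v‖) (hη : etaS i = |i.cf|⁻¹) (hb₁ : 0 ≤ b₁)
    (parS : SiteParY (Matrix (Fin N) (Fin N) ℂ) i) (parB : BondParY (Matrix (Fin N) (Fin N) ℂ) i) (Gp : SiteOpY (Matrix (Fin N) (Fin N) ℂ) i)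
    (ζ : ↥(cubes i.D.toDomains) → SiteY i → ℝ) (hζ : ∀ c z, hTY i c z ≠ 0 → ζ c z = 1)
    (Oc : ↥(cubes i.D.toDomains) → BondOpY (Matrix (Fin N) (Fin N) ℂ) i)
    (Pl P1l : ↥(cubes i.D.toDomains) → Module.End ℂ (FBondY i → Matrix (Fin N) (Fin N) ℂ))
    (hP1 : ∀ c, Pl c * cutMulY (hBdY i (hTY i c)) = cutMulY (hBdY i (hTY i c)) * Pl c + P1l c)
    (hloc : ∀ c, cutMulY (hBdY i (hTY i c)) * (deltaLocY i parB (cfg U₁) - Pl c) * Oc c (cfg U₁) * cutMulY (hBdY i (hTY i c)) =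
      cutMulY (hBdY i (hTY i c)) * cutMulY (hBdY i (hTY i c)))
    (hlocT : ∀ c, cutMulY (hBdY i (hTY i c)) * Oc c (cfg U₁) * (deltaLocY i parB (cfg U₁) - Pl c) * cutMulY (hBdY i (hTY i c)) =
      cutMulY (hBdY i (hTY i c)) * cutMulY (hBdY i (hTY i c)))
    (D Ds : Fin (d + 1) → Module.End ℝ (FBondY i → Matrix (Fin N) (Fin N) ℂ))
    (hD : ∀ ν Λ, D ν Λ = cdB i (cfg U₁) ν Λ) (hDs : ∀ ν Λ, Ds ν Λ = cdsB i (cfg U₁) ν Λ)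
    (Lp : Module.End ℝ (FBondY i → Matrix (Fin N) (Fin N) ℂ)) (hLp : ∀ Λ, Lp Λ = lapB i (cfg U₁) Λ)
    (d' : ℕ) {δ₀ α Θ' θV' B₀ δh : ℝ}
    (hB₀ : 0 ≤ B₀) (hδ₀ : 0 ≤ δ₀) (hΘ' : 0 ≤ Θ') (hθV' : 0 ≤ θV')
    (hαδ : 0 ≤ α * δ₀) (hαδ2 : 0 ≤ (1 - 2 * α) * δ₀)
    (h261 : Ineq261 d' (toB6 (geo9K i) Rr Hp) δ₀ α) (h263 : Ineq263 d' (toB6 (geo9K i) Rr Hp) δ₀ α)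
    (hsmall : ((3 * 5 ^ (d + 1) * (Real.exp (α * δ₀ * (2 * (ℓ : ℝ) + 6)) * B6.c1 d' δ₀ α)) *
        (M₂ * (∑ j, ‖b j‖) * theta389B d ℓ B₀ b₁ δ₀ 1 (2 * δh) (δh * (((ℓ : ℝ) + 1) ^ 2 + 1)) δh 0 * ((geo9K i).M)⁻¹) + Θ') * B6.c1 d' δ₀ α < 1)
    (hsmallV : ((3 * 5 ^ (d + 1) * (Real.exp (α * δ₀ * (2 * (ℓ : ℝ) + 6)) * B6.c1 d' δ₀ α)) *
          (M₂ * (∑ j, ‖b j‖) *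
            ((B₀ * (((d : ℝ) + 1) * (Real.exp (α * δ₀ * 2) * B6.c1 d' δ₀ α) * Real.exp (δ₀ * 2)
                * ((2 * ((d : ℝ) + 1) + 4) * (5 / 8 * C1F d ℓ / i.Mh) + (5 / 8) ^ 2 * (C2F d ℓ + 2 * C2X d ℓ) / (i.Mh : ℝ) ^ 2
                    + 8 * δh * ((ℓ : ℝ) + 1) ^ 5 * (5 / 8 * C1F d ℓ / i.Mh) + 64 * δh * ((ℓ : ℝ) + 1) ^ 7 * (5 / 8 * C1F d ℓ / i.Mh))
              + (Real.exp (α * δ₀ * (2 * (ℓ : ℝ) + 6)) * B6.c1 d' δ₀ α) * Real.exp (δ₀ * (2 * (ℓ : ℝ) + 6))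
                * (4 * b₁ * ((ℓ : ℝ) + 1) ^ 6 * (((ℓ : ℝ) + 1) ^ (d + 1)) ^ 5 * (sLipT d ℓ / (((ℓ : ℝ) + 1) * i.Mh) * (((ℓ : ℝ) + 1) + 3)))))
              * ((ℓ : ℝ) + 1) ^ 5)) + θV') * B6.c1 d' δ₀ α < 1)
    (hE : ∀ c : ↥(cubes i.D.toDomains), EBlock (kernelFamilyBInv i B cfg (Oc c) par) B₀ δ₀ U₁)
    (hU : ∀ μ x, ‖(cfg U₁ μ x : Matrix (Fin N) (Fin N) ℂ)‖ ≤ 1 ∧ ‖(((cfg U₁ μ x)⁻¹ : (Matrix (Fin N) (Fin N) ℂ)ˣ) : Matrix (Fin N) (Fin N) ℂ)‖ ≤ 1)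
    (hT : ∀ (y : IBondY i) (f : FBondY i), ‖(qT i parB (cfg U₁) y f : Matrix (Fin N) (Fin N) ℂ)‖ ≤ 1 ∧
      ‖(((qT i parB (cfg U₁) y f)⁻¹ : (Matrix (Fin N) (Fin N) ℂ)ˣ) : Matrix (Fin N) (Fin N) ℂ)‖ ≤ 1)
    {G : Subgroup (Matrix (Fin N) (Fin N) ℂ)ˣ} {c₀ α₀ : ℝ} (hc : c₀ ≤ 10) (hMα : 0 ≤ (kGeo i).M * α₀)
    (h335 : (bg9KP (Matrix (Fin N) (Fin N) ℂ) G i).Reg335 c₀ α₀ (cfg U₁))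
    (hδK : (2 * (10 * (kGeo i).L * ((kGeo i).M * α₀)) * (1 + 10 * (kGeo i).L * ((kGeo i).M * α₀)) *
        Real.exp (4 * (10 * (kGeo i).L * ((kGeo i).M * α₀))) * ((ℓ : ℝ) + 1) ^ 2) ≤ δh)
    (hrest : HasMajorant (g := toB6 (geo9K i) Rr Hp) (fun p : FBondY i × ι => ιB (blkV1 i.hN i.D p.1))
      (∑ c, conj b (((1 - cutMulY (hBdY i (ζ c))) * DPDsY i parS Gp (cfg U₁) *
            (cutMulY (hBdY i (hTY i c)) * Oc c (cfg U₁) * cutMulY (hBdY i (hTY i c)))).restrictScalars ℝ)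
        + ∑ c, conj b ((cutMulY (hBdY i (ζ c)) * (DPDsY i parS Gp (cfg U₁) - Pl c) *
            (cutMulY (hBdY i (hTY i c)) * Oc c (cfg U₁) * cutMulY (hBdY i (hTY i c)))).restrictScalars ℝ)
        + ∑ c, conj b ((cutMulY (hBdY i (ζ c)) * P1l c * Oc c (cfg U₁) * cutMulY (hBdY i (hTY i c))).restrictScalars ℝ))
      (fun a a' => Θ' * Real.exp (-(δ₀ * (geo9K i).dist a a'))))
    (hV' : HasMajorant (g := toB6 (geo9K i) Rr Hp) (fun p : FBondY i × ι => ιB (blkV1 i.hN i.D p.1))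
      (-(∑ c, conj b ((cutMulY (hBdY i (hTY i c)) * Oc c (cfg U₁) * P1l c).restrictScalars ℝ))
        + ∑ c, conj b ((cutMulY (hBdY i (hTY i c)) * Oc c (cfg U₁) * cutMulY (hBdY i (hTY i c)) *
            (cutMulY (hBdY i (ζ c)) * (DPDsY i parS Gp (cfg U₁) - Pl c))).restrictScalars ℝ)
        + ∑ c, conj b ((cutMulY (hBdY i (hTY i c)) * Oc c (cfg U₁) * cutMulY (hBdY i (hTY i c)) *
            ((1 - cutMulY (hBdY i (ζ c))) * DPDsY i parS Gp (cfg U₁))).restrictScalars ℝ))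
      (fun a a' => θV' * (geo9K i).len a * ((geo9K i).len a')⁻¹ * Real.exp (-(δ₀ * (geo9K i).dist a a')))) :
    EBlock (kernelFamilyBInv i B cfg (GAY i parS parB Gp) par)
      (M₂ * (∑ j, ‖b j‖) *
        ((3 * 5 ^ (d + 1)) * (M₂ * (∑ j, ‖b j‖) * B₀) * B6.c1 d' δ₀ α *
            (1 - ((3 * 5 ^ (d + 1) * (Real.exp (α * δ₀ * (2 * (ℓ : ℝ) + 6)) * B6.c1 d' δ₀ α)) *
              (M₂ * (∑ j, ‖b j‖) * theta389B d ℓ B₀ b₁ δ₀ 1 (2 * δh) (δh * (((ℓ : ℝ) + 1) ^ 2 + 1)) δh 0 * ((geo9K i).M)⁻¹) + Θ') *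
              B6.c1 d' δ₀ α)⁻¹ +
          ((3 * 5 ^ (d + 1) * (Real.exp (α * δ₀ * (2 * (ℓ : ℝ) + 6)) * B6.c1 d' δ₀ α)) *
              (M₂ * (∑ j, ‖b j‖) * (B₀ * (1 + 5 * C1F d ℓ * (((ℓ : ℝ) + 1) * Real.exp δ₀) / (8 * (i.Mh : ℝ)))))) * B6.c1 d' δ₀ α *
            (1 - ((3 * 5 ^ (d + 1) * (Real.exp (α * δ₀ * (2 * (ℓ : ℝ) + 6)) * B6.c1 d' δ₀ α)) *
              (M₂ * (∑ j, ‖b j‖) * theta389B d ℓ B₀ b₁ δ₀ 1 (2 * δh) (δh * (((ℓ : ℝ) + 1) ^ 2 + 1)) δh 0 * ((geo9K i).M)⁻¹) + Θ') *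
              B6.c1 d' δ₀ α)⁻¹ +
          ((3 * 5 ^ (d + 1) * (Real.exp (α * δ₀ * (2 * (ℓ : ℝ) + 6)) * B6.c1 d' δ₀ α)) *
              (M₂ * (∑ j, ‖b j‖) * (B₀ * (1 + Real.exp (α * δ₀) * B6.c1 d' δ₀ α * Real.exp δ₀ * (5 / 8 * C1F d ℓ / i.Mh))))) * B6.c1 d' δ₀ α *
            (1 - ((3 * 5 ^ (d + 1) * (Real.exp (α * δ₀ * (2 * (ℓ : ℝ) + 6)) * B6.c1 d' δ₀ α)) *
                (M₂ * (∑ j, ‖b j‖) *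
                  ((B₀ * (((d : ℝ) + 1) * (Real.exp (α * δ₀ * 2) * B6.c1 d' δ₀ α) * Real.exp (δ₀ * 2)
                      * ((2 * ((d : ℝ) + 1) + 4) * (5 / 8 * C1F d ℓ / i.Mh) + (5 / 8) ^ 2 * (C2F d ℓ + 2 * C2X d ℓ) / (i.Mh : ℝ) ^ 2
                          + 8 * δh * ((ℓ : ℝ) + 1) ^ 5 * (5 / 8 * C1F d ℓ / i.Mh) + 64 * δh * ((ℓ : ℝ) + 1) ^ 7 * (5 / 8 * C1F d ℓ / i.Mh))
                    + (Real.exp (α * δ₀ * (2 * (ℓ : ℝ) + 6)) * B6.c1 d' δ₀ α) * Real.exp (δ₀ * (2 * (ℓ : ℝ) + 6))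
                      * (4 * b₁ * ((ℓ : ℝ) + 1) ^ 6 * (((ℓ : ℝ) + 1) ^ (d + 1)) ^ 5 * (sLipT d ℓ / (((ℓ : ℝ) + 1) * i.Mh) * (((ℓ : ℝ) + 1) + 3)))))
                    * ((ℓ : ℝ) + 1) ^ 5)) + θV') * B6.c1 d' δ₀ α)⁻¹ +
          ((3 * 5 ^ (d + 1) * (Real.exp (α * δ₀ * (2 * (ℓ : ℝ) + 6)) * B6.c1 d' δ₀ α)) *
              (M₂ * (∑ j, ‖b j‖) * (B₀ * (1 + ((d : ℝ) + 1) * (5 / 8 * C1F d ℓ / i.Mh * (Real.exp δ₀ + 1) + 25 / 64 * C2F d ℓ / i.Mh ^ 2))))) * B6.c1 d' δ₀ α *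
            (1 - ((3 * 5 ^ (d + 1) * (Real.exp (α * δ₀ * (2 * (ℓ : ℝ) + 6)) * B6.c1 d' δ₀ α)) *
              (M₂ * (∑ j, ‖b j‖) * theta389B d ℓ B₀ b₁ δ₀ 1 (2 * δh) (δh * (((ℓ : ℝ) + 1) ^ 2 + 1)) δh 0 * ((geo9K i).M)⁻¹) + Θ') *
              B6.c1 d' δ₀ α)⁻¹))
      ((1 - 2 * α) * δ₀) U₁ := by
  have hL0 : 0 ≤ (kGeo i).L := zero_le_one.trans (B9Eq335PlaquetteAtLettersY.one_le_L i)
  have hK : 0 ≤ 10 * (kGeo i).L * ((kGeo i).M * α₀) := mul_nonneg (mul_nonneg (by norm_num) hL0) hMα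
  have hδK0 : 0 ≤ (2 * (10 * (kGeo i).L * ((kGeo i).M * α₀)) * (1 + 10 * (kGeo i).L * ((kGeo i).M * α₀)) *
      Real.exp (4 * (10 * (kGeo i).L * ((kGeo i).M * α₀))) * ((ℓ : ℝ) + 1) ^ 2) := by positivity
  have hδh : 0 ≤ δh := hδK0.trans hδK
  have hW : ∀ p : PlaqY i, ‖((holY i (cfg U₁) p : (Matrix (Fin N) (Fin N) ℂ)ˣ) : Matrix (Fin N) (Fin N) ℂ) - 1‖ ≤
      δh * ((((ℓ : ℝ) + 1) ^ levY i (chartY i p.src))⁻¹) ^ 2 := fun p =>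
    (plaquetteDefect_of_reg335P i (cfg U₁) hc hMα h335 p).trans (mul_le_mul_of_nonneg_right hδK (sq_nonneg _))
  exact eBlock_kernelFamilyBInv_GAY_of_localInverseCubes''_exact i b ιB cfg par hι hM₂ hrepr hη hb₁ parS parB Gp ζ hζ Oc Pl P1l hP1 hloc hlocT
    D Ds hD hDs Lp hLp d' hB₀ hδ₀ hΘ' hθV' hδh hαδ hαδ2 h261 h263 hsmall hsmallV hE hU hT hW hrest hV'

/-! ## §2 (v1.2) The same for the landed consumer at r05's whole-torus cube letters `GACubeY` -/

/-- ★★★ **THE LANDED CONSUMER AT r05's LETTERS, ON PRINT'S CLASS (3.35)** (fibre `M_N(ℂ)`, `N ≥ 1`):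
`B9Thm310DeltaAIsUnitOfExpansion.eBlock_kernelFamilyBInv_GAY_of_coverCubes''` (= `B9Thm310TransposedCommutatorBMajorant.eBlock_kernelFamilyBInv_GAY_of_coverCubes'`
without `hinvU`) at `𝔸 := M_N(ℂ)` with the plaquette datum `hW` and `0 ≤ δ̂` read off `U₁ ∈` (3.35) (`…DataOfPlaquettes.plaquetteDefect_of_reg335P`; any
`δ̂ ≥ 2K(1+K)e^{4K}·L²`, `K := 10L·(Mα₀)`).  Displayed (as there): `hinvC : ∀ □, IsUnit Δ_{a,□}(U₁)` (r05's `B9Thm311CubeLettersG*` supply it in their regimes at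
`parS := parSymY i`, `parB := parBY i`), the letters' (3.42) blocks `hE`, `hrest`∕`hV′` (families 2–4), `hU`∕`hT`, `η = |c_f|⁻¹`, `0 ≤ b₁`, [4] Lemma 2.1, the two
smallness conditions.
[cite: Balaban1985BackgroundPropagators, Thm 3.3 p.399 (3.42) p.397 via Thm 3.10 pp.414–416, (3.35) p.396, (3.69) p.404, (3.105)–(3.106) p.414, (3.87) p.409, p.409 l.3–5, p.408 («Ω_n(□) ⊂ Ω_n»); Balaban1984PropagatorsII, Prop. 2.2 (2.65)–(2.67) p.234, Lemma 2.1 (2.61) p.234] -/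
theorem eBlock_kernelFamilyBInv_GAY_of_coverCubes''_of_reg335P (hι : ∀ s, β i.hN i.D i.hk (ιB s) = s)
    {M₂ : ℝ} (hM₂ : 0 ≤ M₂) (hrepr : ∀ (v : Matrix (Fin N) (Fin N) ℂ) (j : ι), |b.repr v j| ≤ M₂ * ‖v‖) (hη : etaS i = |i.cf|⁻¹) (hb₁ : 0 ≤ b₁)
    (parS : SiteParY (Matrix (Fin N) (Fin N) ℂ) i) (parB : BondParY (Matrix (Fin N) (Fin N) ℂ) i) (Gp : SiteOpY (Matrix (Fin N) (Fin N) ℂ) i)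
    (ζ : ↥(cubes i.D.toDomains) → SiteY i → ℝ) (hζ : ∀ c z, hTY i c z ≠ 0 → ζ c z = 1)
    (hinvC : ∀ c : ↥(cubes i.D.toDomains), IsUnit (deltaACubeY i c parS parB (cfg U₁)))
    (D Ds : Fin (d + 1) → Module.End ℝ (FBondY i → Matrix (Fin N) (Fin N) ℂ))
    (hD : ∀ ν Λ, D ν Λ = cdB i (cfg U₁) ν Λ) (hDs : ∀ ν Λ, Ds ν Λ = cdsB i (cfg U₁) ν Λ)
    (Lp : Module.End ℝ (FBondY i → Matrix (Fin N) (Fin N) ℂ)) (hLp : ∀ Λ, Lp Λ = lapB i (cfg U₁) Λ)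
    (d' : ℕ) {δ₀ α Θ' θV' B₀ δh : ℝ}
    (hB₀ : 0 ≤ B₀) (hδ₀ : 0 ≤ δ₀) (hΘ' : 0 ≤ Θ') (hθV' : 0 ≤ θV')
    (hαδ : 0 ≤ α * δ₀) (hαδ2 : 0 ≤ (1 - 2 * α) * δ₀)
    (h261 : Ineq261 d' (toB6 (geo9K i) Rr Hp) δ₀ α) (h263 : Ineq263 d' (toB6 (geo9K i) Rr Hp) δ₀ α)
    (hsmall : ((3 * 5 ^ (d + 1) * (Real.exp (α * δ₀ * (2 * (ℓ : ℝ) + 6)) * B6.c1 d' δ₀ α)) *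
        (M₂ * (∑ j, ‖b j‖) * theta389B d ℓ B₀ b₁ δ₀ 1 (2 * δh) (δh * (((ℓ : ℝ) + 1) ^ 2 + 1)) δh 0 * ((geo9K i).M)⁻¹) + Θ') * B6.c1 d' δ₀ α < 1)
    (hsmallV : ((3 * 5 ^ (d + 1) * (Real.exp (α * δ₀ * (2 * (ℓ : ℝ) + 6)) * B6.c1 d' δ₀ α)) *
          (M₂ * (∑ j, ‖b j‖) *
            ((B₀ * (((d : ℝ) + 1) * (Real.exp (α * δ₀ * 2) * B6.c1 d' δ₀ α) * Real.exp (δ₀ * 2)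
                * ((2 * ((d : ℝ) + 1) + 4) * (5 / 8 * C1F d ℓ / i.Mh) + (5 / 8) ^ 2 * (C2F d ℓ + 2 * C2X d ℓ) / (i.Mh : ℝ) ^ 2
                    + 8 * δh * ((ℓ : ℝ) + 1) ^ 5 * (5 / 8 * C1F d ℓ / i.Mh) + 64 * δh * ((ℓ : ℝ) + 1) ^ 7 * (5 / 8 * C1F d ℓ / i.Mh))
              + (Real.exp (α * δ₀ * (2 * (ℓ : ℝ) + 6)) * B6.c1 d' δ₀ α) * Real.exp (δ₀ * (2 * (ℓ : ℝ) + 6))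
                * (4 * b₁ * ((ℓ : ℝ) + 1) ^ 6 * (((ℓ : ℝ) + 1) ^ (d + 1)) ^ 5 * (sLipT d ℓ / (((ℓ : ℝ) + 1) * i.Mh) * (((ℓ : ℝ) + 1) + 3)))))
              * ((ℓ : ℝ) + 1) ^ 5)) + θV') * B6.c1 d' δ₀ α < 1)
    (hE : ∀ c : ↥(cubes i.D.toDomains), EBlock (kernelFamilyBInv i B cfg (GACubeY i c parS parB) par) B₀ δ₀ U₁)
    (hU : ∀ μ x, ‖(cfg U₁ μ x : Matrix (Fin N) (Fin N) ℂ)‖ ≤ 1 ∧ ‖(((cfg U₁ μ x)⁻¹ : (Matrix (Fin N) (Fin N) ℂ)ˣ) : Matrix (Fin N) (Fin N) ℂ)‖ ≤ 1)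
    (hT : ∀ (y : IBondY i) (f : FBondY i), ‖(qT i parB (cfg U₁) y f : Matrix (Fin N) (Fin N) ℂ)‖ ≤ 1 ∧
      ‖(((qT i parB (cfg U₁) y f)⁻¹ : (Matrix (Fin N) (Fin N) ℂ)ˣ) : Matrix (Fin N) (Fin N) ℂ)‖ ≤ 1)
    {G : Subgroup (Matrix (Fin N) (Fin N) ℂ)ˣ} {c₀ α₀ : ℝ} (hc : c₀ ≤ 10) (hMα : 0 ≤ (kGeo i).M * α₀)
    (h335 : (bg9KP (Matrix (Fin N) (Fin N) ℂ) G i).Reg335 c₀ α₀ (cfg U₁))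
    (hδK : (2 * (10 * (kGeo i).L * ((kGeo i).M * α₀)) * (1 + 10 * (kGeo i).L * ((kGeo i).M * α₀)) *
        Real.exp (4 * (10 * (kGeo i).L * ((kGeo i).M * α₀))) * ((ℓ : ℝ) + 1) ^ 2) ≤ δh)
    (hrest : HasMajorant (g := toB6 (geo9K i) Rr Hp) (fun p : FBondY i × ι => ιB (blkV1 i.hN i.D p.1))
      (∑ c, conj b (((1 - cutMulY (hBdY i (ζ c))) * DPDsY i parS Gp (cfg U₁) *
            (cutMulY (hBdY i (hTY i c)) * GACubeY i c parS parB (cfg U₁) * cutMulY (hBdY i (hTY i c)))).restrictScalars ℝ)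
        + ∑ c, conj b ((cutMulY (hBdY i (ζ c)) * (DPDsY i parS Gp (cfg U₁) - DPDsCubeY i c parS (cfg U₁)) *
            (cutMulY (hBdY i (hTY i c)) * GACubeY i c parS parB (cfg U₁) * cutMulY (hBdY i (hTY i c)))).restrictScalars ℝ)
        + ∑ c, conj b ((cutMulY (hBdY i (ζ c)) * P1CubeY i c (hTY i c) parS (cfg U₁) * GACubeY i c parS parB (cfg U₁) *
            cutMulY (hBdY i (hTY i c))).restrictScalars ℝ))
      (fun a a' => Θ' * Real.exp (-(δ₀ * (geo9K i).dist a a'))))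
    (hV' : HasMajorant (g := toB6 (geo9K i) Rr Hp) (fun p : FBondY i × ι => ιB (blkV1 i.hN i.D p.1))
      (-(∑ c, conj b ((cutMulY (hBdY i (hTY i c)) * GACubeY i c parS parB (cfg U₁) * P1CubeY i c (hTY i c) parS (cfg U₁)).restrictScalars ℝ))
        + ∑ c, conj b ((cutMulY (hBdY i (hTY i c)) * GACubeY i c parS parB (cfg U₁) * cutMulY (hBdY i (hTY i c)) *
            (cutMulY (hBdY i (ζ c)) * (DPDsY i parS Gp (cfg U₁) - DPDsCubeY i c parS (cfg U₁)))).restrictScalars ℝ)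
        + ∑ c, conj b ((cutMulY (hBdY i (hTY i c)) * GACubeY i c parS parB (cfg U₁) * cutMulY (hBdY i (hTY i c)) *
            ((1 - cutMulY (hBdY i (ζ c))) * DPDsY i parS Gp (cfg U₁))).restrictScalars ℝ))
      (fun a a' => θV' * (geo9K i).len a * ((geo9K i).len a')⁻¹ * Real.exp (-(δ₀ * (geo9K i).dist a a')))) :
    EBlock (kernelFamilyBInv i B cfg (GAY i parS parB Gp) par)
      (M₂ * (∑ j, ‖b j‖) *
        ((3 * 5 ^ (d + 1)) * (M₂ * (∑ j, ‖b j‖) * B₀) * B6.c1 d' δ₀ α *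
            (1 - ((3 * 5 ^ (d + 1) * (Real.exp (α * δ₀ * (2 * (ℓ : ℝ) + 6)) * B6.c1 d' δ₀ α)) *
              (M₂ * (∑ j, ‖b j‖) * theta389B d ℓ B₀ b₁ δ₀ 1 (2 * δh) (δh * (((ℓ : ℝ) + 1) ^ 2 + 1)) δh 0 * ((geo9K i).M)⁻¹) + Θ') *
              B6.c1 d' δ₀ α)⁻¹ +
          ((3 * 5 ^ (d + 1) * (Real.exp (α * δ₀ * (2 * (ℓ : ℝ) + 6)) * B6.c1 d' δ₀ α)) *
              (M₂ * (∑ j, ‖b j‖) * (B₀ * (1 + 5 * C1F d ℓ * (((ℓ : ℝ) + 1) * Real.exp δ₀) / (8 * (i.Mh : ℝ)))))) * B6.c1 d' δ₀ α *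
            (1 - ((3 * 5 ^ (d + 1) * (Real.exp (α * δ₀ * (2 * (ℓ : ℝ) + 6)) * B6.c1 d' δ₀ α)) *
              (M₂ * (∑ j, ‖b j‖) * theta389B d ℓ B₀ b₁ δ₀ 1 (2 * δh) (δh * (((ℓ : ℝ) + 1) ^ 2 + 1)) δh 0 * ((geo9K i).M)⁻¹) + Θ') *
              B6.c1 d' δ₀ α)⁻¹ +
          ((3 * 5 ^ (d + 1) * (Real.exp (α * δ₀ * (2 * (ℓ : ℝ) + 6)) * B6.c1 d' δ₀ α)) *
              (M₂ * (∑ j, ‖b j‖) * (B₀ * (1 + Real.exp (α * δ₀) * B6.c1 d' δ₀ α * Real.exp δ₀ * (5 / 8 * C1F d ℓ / i.Mh))))) * B6.c1 d' δ₀ α *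
            (1 - ((3 * 5 ^ (d + 1) * (Real.exp (α * δ₀ * (2 * (ℓ : ℝ) + 6)) * B6.c1 d' δ₀ α)) *
                (M₂ * (∑ j, ‖b j‖) *
                  ((B₀ * (((d : ℝ) + 1) * (Real.exp (α * δ₀ * 2) * B6.c1 d' δ₀ α) * Real.exp (δ₀ * 2)
                      * ((2 * ((d : ℝ) + 1) + 4) * (5 / 8 * C1F d ℓ / i.Mh) + (5 / 8) ^ 2 * (C2F d ℓ + 2 * C2X d ℓ) / (i.Mh : ℝ) ^ 2
                          + 8 * δh * ((ℓ : ℝ) + 1) ^ 5 * (5 / 8 * C1F d ℓ / i.Mh) + 64 * δh * ((ℓ : ℝ) + 1) ^ 7 * (5 / 8 * C1F d ℓ / i.Mh))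
                    + (Real.exp (α * δ₀ * (2 * (ℓ : ℝ) + 6)) * B6.c1 d' δ₀ α) * Real.exp (δ₀ * (2 * (ℓ : ℝ) + 6))
                      * (4 * b₁ * ((ℓ : ℝ) + 1) ^ 6 * (((ℓ : ℝ) + 1) ^ (d + 1)) ^ 5 * (sLipT d ℓ / (((ℓ : ℝ) + 1) * i.Mh) * (((ℓ : ℝ) + 1) + 3)))))
                    * ((ℓ : ℝ) + 1) ^ 5)) + θV') * B6.c1 d' δ₀ α)⁻¹ +
          ((3 * 5 ^ (d + 1) * (Real.exp (α * δ₀ * (2 * (ℓ : ℝ) + 6)) * B6.c1 d' δ₀ α)) *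
              (M₂ * (∑ j, ‖b j‖) * (B₀ * (1 + ((d : ℝ) + 1) * (5 / 8 * C1F d ℓ / i.Mh * (Real.exp δ₀ + 1) + 25 / 64 * C2F d ℓ / i.Mh ^ 2))))) * B6.c1 d' δ₀ α *
            (1 - ((3 * 5 ^ (d + 1) * (Real.exp (α * δ₀ * (2 * (ℓ : ℝ) + 6)) * B6.c1 d' δ₀ α)) *
              (M₂ * (∑ j, ‖b j‖) * theta389B d ℓ B₀ b₁ δ₀ 1 (2 * δh) (δh * (((ℓ : ℝ) + 1) ^ 2 + 1)) δh 0 * ((geo9K i).M)⁻¹) + Θ') *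
              B6.c1 d' δ₀ α)⁻¹))
      ((1 - 2 * α) * δ₀) U₁ := by
  have hL0 : 0 ≤ (kGeo i).L := zero_le_one.trans (B9Eq335PlaquetteAtLettersY.one_le_L i)
  have hK : 0 ≤ 10 * (kGeo i).L * ((kGeo i).M * α₀) := mul_nonneg (mul_nonneg (by norm_num) hL0) hMα
  have hδK0 : 0 ≤ (2 * (10 * (kGeo i).L * ((kGeo i).M * α₀)) * (1 + 10 * (kGeo i).L * ((kGeo i).M * α₀)) *
      Real.exp (4 * (10 * (kGeo i).L * ((kGeo i).M * α₀))) * ((ℓ : ℝ) + 1) ^ 2) := by positivity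
  have hδh : 0 ≤ δh := hδK0.trans hδK
  have hW : ∀ p : PlaqY i, ‖((holY i (cfg U₁) p : (Matrix (Fin N) (Fin N) ℂ)ˣ) : Matrix (Fin N) (Fin N) ℂ) - 1‖ ≤
      δh * ((((ℓ : ℝ) + 1) ^ levY i (chartY i p.src))⁻¹) ^ 2 := fun p =>
    (plaquetteDefect_of_reg335P i (cfg U₁) hc hMα h335 p).trans (mul_le_mul_of_nonneg_right hδK (sq_nonneg _))
  exact eBlock_kernelFamilyBInv_GAY_of_coverCubes'' i b ιB cfg par hι hM₂ hrepr hη hb₁ parS parB Gp ζ hζ hinvC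
    D Ds hD hDs Lp hLp d' hB₀ hδ₀ hΘ' hθV' hδh hαδ hαδ2 h261 h263 hsmall hsmallV hE hU hT hW hrest hV'

end Reg335

end Literature.MathematicalPhysics.QuantumFieldTheory.Balaban1983to89.B9Thm310GOfLocalInverseReg335

end
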